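import Summits.CriticalPhenomena.PercolationContinuityZ3.Theorems.Transplant.SkelFrmQuasiProxHoldsAll
import HarnessLib

/-!
# The SAME-`p` DROP FORM of the quasi-step node (rung Q; the «optional append row» named in the module doc of «SkelFrmQuasiProxHoldsAll»):
# **for every locally finite graph carrying a `PlanarSkeletonFrmQuasi`, every base type `t` with proxies, and EVERY density `p` with subcritical cylinders
# (`Φ.CylSubcritical p`) and `θ_t(p) > 0`, some `q < p` has `θ_t(q) > 0`** — no growth, uniqueness or `p < 1` hypothesis.

builds on p205010 (kernel theorem, internal audit signed; external expert review pending).  Lane `prim-bschramm`, seat `prim-bschramm-gen-2` (GEN-Q port pen #2,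
generation 2); helper file (`--supports stmt-CriticalPhenomena-4575 --as helper`).  PORT, NO NEW MATHEMATICS: §1 is the T6 carrier port
(`PlanarSkeletonFrmFrom ↦ PlanarSkeletonFrmQuasi`) of «PlanarSkeletonFrmFrom1Px» §2's second theorem `PlanarSkeletonFrmFrom.drop_of_choiceFnNQLTKPxAt_at`
(left un-ported in the GEN-Q row G238 «PlanarSkeletonFrmQuasi1Px» because it is outside the node top's used cone — see the `-- GEN-Q (R-2 …)` line there; body =
the carrier-free `drop_at_of_critical` of «PlanarSkeletonFrmFrom1Px» §1 composed with the Quasi closure `PlanarSkeletonFrmQuasi.theta_criticalProbIOf_eq_zero_of_choiceFnNQLTKPxAt`,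
verbatim); §2 is the twin of «SkelFrmFromProxHoldsAll» p486426 §1 `frmFromProx_drop_holds` at the four GEN-Q column tops of record (Geom «SkelFrmQuasiBChoiceGeomVPx» ·
(R) «SkelFrmQuasi1RootHoldsQ3VNodePx» · (F) «SkelFrmQuasi1FaceHoldsQ3VNodePx» · (C) «SkelFrmQuasi1ReachHoldsQ3VNodePx») and the tuple Px — the SAME term as the node's
`frmQuasiProx_criticalContinuity_holds` with `Φ ht hP hC` replaced by `Φ ht hP p hC hθ`.  In the FrmFrom twin the hypothesis `hC : Φ.CylSubcritical p` is already AT `p`,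
so the quasi-step version carries no extra hypothesis.  A NEW FILE importing the node (nothing BUILT is edited or rebuilt).  Nothing here edits or restates a `@[conjecture]`;
nothing is claimed about `BenjaminiSchramm1996_conj4_endState`, chartless classes or general transitive graphs; nothing about any open node is claimed.
[cite: BenjaminiSchramm1996, Conj. 4] [cite: KozmaNitzan2024, §1 p. 2 (approach 1); §4 Theorem 6 (pp. 25–31)] [cite: Hutchcroft2016, Thm. 1] [cite: LyonsPeres2016, Thm. 7.6]
-/

noncomputable section

namespace Summit.CriticalPhenomena.PercolationContinuityZ3.Theorems

namespace Transplant

open MeasureTheory Literature.Probability.Percolation Literature.Probability.LatticeModels SimpleGraph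
open Literature.Barriers.CriticalPhenomena (countable_of_connected_of_locallyFinite)
open scoped Classical

/-! ## §1 The closure lemma: the same-`p` drop at a base type with proxies, from the four GEN column obligations (carrier port of «PlanarSkeletonFrmFrom1Px» §2) -/

namespace PlanarSkeletonFrmQuasi

variable {V : Type} {G : SimpleGraph V} [G.LocallyFinite]

/-- **THE SAME-`p` DROP AT A BASE TYPE WITH PROXIES, from the GEN column obligations — no growth, uniqueness or `p < 1` hypotheses** (quasi-step carrier): under
the hypotheses of `theta_criticalProbIOf_eq_zero_of_choiceFnNQLTKPxAt` on `𝒞₀`, every `p` with subcritical cylinders and `θ_t(p) > 0` admits `q < p` with `θ_t(q) > 0`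
(«PlanarSkeletonFrmFrom1Px» §1 `drop_at_of_critical` ∘ the closure).  Carrier port of `PlanarSkeletonFrmFrom.drop_of_choiceFnNQLTKPxAt_at`, text verbatim.
[cite: BenjaminiSchramm1996, Conj. 4] [cite: KozmaNitzan2024, §1 p. 2 (approach 1)] -/
theorem drop_of_choiceFnNQLTKPxAt_at (Lf : ℕ → ℕ) (dT : ℝ → ℝ) (hdT : ∀ x : ℝ, 0 < x → 0 < dT x) (Kmin : ℕ) {D : ℕ}
    (𝒞₀ : ChoiceFnNQPxAt D) (hGm : GeomHoldsNQFnPxAt 𝒞₀) (hR : RootHoldsNQWFnLKPxAt Lf Kmin 𝒞₀)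
    (hF : FaceHoldsRNQFnLTKPxAt Lf dT Kmin 𝒞₀) (hRe : ReachHoldsRHNQFnLKPxAt Lf Kmin 𝒞₀)
    (Φ : PlanarSkeletonFrmQuasi G) {t : V} (ht : t ∈ Φ.types) (hP : Φ.HasProxies t D) (p : unitInterval) (hC : Φ.CylSubcritical p) (hθ : 0 < theta G t p) :
    ∃ q : unitInterval, (q : ℝ) < p ∧ 0 < theta G t q :=
  haveI : Countable V := countable_of_connected_of_locallyFinite G (Φ.graph_connected t) t
  drop_at_of_critical G t (P := fun r => Φ.CylSubcritical r)
    (fun hCc => theta_criticalProbIOf_eq_zero_of_choiceFnNQLTKPxAt Lf dT hdT Kmin 𝒞₀ hGm hR hF hRe Φ ht hP hCc) p hC hθ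

end PlanarSkeletonFrmQuasi

/-! ## §2 The drop form of the node at the tuple Px of record -/

/-- **The same-`p` drop for the multi-type quasi-step carrier with proxies** — on a locally finite graph `G` carrying a `PlanarSkeletonFrmQuasi Φ`, at every base type
`t ∈ Φ.types` with proxies at some radius `Dp`, every density `p` with subcritical cylinders (`Φ.CylSubcritical p`) and `θ_t(p) > 0` admits `q < p` with `θ_t(q) > 0`;
no growth, uniqueness or `p < 1` hypothesis (§1 `PlanarSkeletonFrmQuasi.drop_of_choiceFnNQLTKPxAt_at` at the four GEN-Q column tops — the node's term with `p hC hθ`).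
Twin of «SkelFrmFromProxHoldsAll» `frmFromProx_drop_holds`.
builds on p205010 (kernel theorem, internal audit signed; external expert review pending). [cite: BenjaminiSchramm1996, Conj. 4] [cite: KozmaNitzan2024, §4] -/
theorem frmQuasiProx_drop_holds {V : Type} (G : SimpleGraph V) [G.LocallyFinite] (Φ : PlanarSkeletonFrmQuasi G) {t : V} (ht : t ∈ Φ.types)
    {Dp : ℕ} (hP : Φ.HasProxies t Dp) (p : unitInterval) (hC : Φ.CylSubcritical p) (hθ : 0 < theta G t p) :
    ∃ q : unitInterval, (q : ℝ) < p ∧ 0 < theta G t q :=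
  PlanarSkeletonFrmQuasi.drop_of_choiceFnNQLTKPxAt_at PlanarSkeletonFrm.NegB.LfQ (fun x : ℝ => x ^ 3) (fun _ hx => pow_pos hx 3) 480
    (PlanarSkeletonFrmQuasi.frmChoiceAllQ3VPx Dp (PlanarSkeletonFrmQuasi.NegB.gvPx Dp) (PlanarSkeletonFrmQuasi.NegB.fvPx Dp) (PlanarSkeletonFrmQuasi.NegB.PvPx Dp)
      (PlanarSkeletonFrmQuasi.NegB.SUS (PlanarSkeletonFrmQuasi.NegB.exPx Dp) (PlanarSkeletonFrmQuasi.NegB.mxPx Dp)) (PlanarSkeletonFrmQuasi.NegB.cvPx Dp)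
      (PlanarSkeletonFrmQuasi.NegB.hvPx Dp) PlanarSkeletonFrmQuasi.NegB.BSlot.small3)
    (PlanarSkeletonFrmQuasi.geomHoldsNQFnPxAt_frmChoiceAllQ3VPx Dp _ _ _ _ _ _ _)
    (PlanarSkeletonFrmQuasi.NegB.rootHoldsNQWFnLKPxAt_frmChoiceAllQ3VPx_node Dp 480 (by norm_num))
    (PlanarSkeletonFrmQuasi.NegB.faceHoldsRNQFnLTKPxAt_frmChoiceAllQ3VPx_node Dp 480 le_rfl)
    (PlanarSkeletonFrmQuasi.reachHoldsRHNQFnLKPxAt_frmChoiceAllQ3VPx_node Dp 480 (by norm_num))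
    Φ ht hP p hC hθ

end Transplant

end Summit.CriticalPhenomena.PercolationContinuityZ3.Theorems

end
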